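import Summits.BirchSwinnertonDyer.BirchSwinnertonDyer.Theorems.BiquadraticEisensteinDescentHeegnerTwistCouplingInSupplySymbolicMonskyEvenDesignNoSevenDoorIff
import Summits.BirchSwinnertonDyer.BirchSwinnertonDyer.Theorems.BiquadraticEisensteinDescentHeegnerTwistCouplingInSupplySymbolicMonskyOddDesignNoSeven
import HarnessLib

set_option linter.dupNamespace false -- `Summit.BirchSwinnertonDyer.BirchSwinnertonDyer.Theorems.…` (summit = sub)
set_option autoImplicit false

/-!
# Crux `HeegnerTwistCouplingInSupply` (stmt-BirchSwinnertonDyer-21381) — class families on which the one-stage door is ALWAYS open: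
# even bases with classes `{1,3,5} (mod 8)` and at most THREE primes `≡ 5 (mod 8)`; odd bases with classes `{1,3,5}` and ONE prime `≡ 5 (mod 8)`

Route `BiquadraticEisensteinDescent` (cell `pub/bsd-wall`, width seat `bsd-wall-cm-bed-w3` g25; `--supports` 21381, helper). By the exact doors of
`…EvenDesignNoSevenDoorIff` (p760878) and `…OddDesignNoSeven` (p760030) the one-stage door on bases with no prime `≡ 7 (mod 8)` is governed by a
single number: even — the vertical kernel pairs `a₁ = dim{(0,v) ∈ 𝒦_ev}` against `τ₀ = (dim 𝒦_ev + 1)/2`; odd — `dim (𝒦⁺(1) ∩ V×0)` against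
`τ₀ = (dim 𝒦 + 1)/2`. This file bounds that number by class counting alone (no hypothesis on the symbols `(P_j/P_i)`):
* ★★ `finrank_vertical_le_of_three_fives` — EVEN, ANY classes, at most three primes `≡ 5 (mod 8)` (indices `b₁, b₂, b₃`, repeats allowed):
  `a₁ ≤ τ₀`, i.e. a «vertical» exceptional base needs ≥ 4 primes `≡ 5 (mod 8)`. Mechanism: a vertical pair `(0, v)` has `v|_M = 0` and `Lv = D_d v` with `Σ_b d_b v_b = 0` (column sums); imposing
  `v_{b₁} = v_{b₂} = 0` (codimension ≤ 2) forces `v_{b₃} = 0` by that parity, so `v|_D = 0`, `Lv = 0` and the SWAP `(v, 0)` is an even kernel pair;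
  the two sections `𝒦_ev ∩ 0×V`, `𝒦_ev ∩ V×0` are disjoint in `𝒦_ev` of odd dimension `s`, whence `2a₁ − 2 ≤ s`, i.e. `a₁ ≤ τ₀`. The exhaustive
  censuses of memo EVEN-EXCEPTIONAL-CLASS-w3g24 (§0, §2e: every vertical-exceptional base with `K ≤ 6` has ≥ four primes `≡ 5 (mod 8)`) are thus
  explained and extended to all `K`; numerics w3 g25 probe25.py: 6 217 bases with ≤ 3 such primes, 0 exceptional; 8 % exceptional with four.
* ★★★ `exists_patternFree_even_design_of_three_fives` / `exists_recipe_cruxOn_even_of_three_fives` — hence EVERY even base `E_{2·P₀⋯P_k}` with all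
  `P_b ≡ 1, 3, 5 (mod 8)`, an odd number of them `≡ 3 (mod 8)` and at most three `≡ 5 (mod 8)` admits a pattern-free Heegner recipe with `τ₀ + 1`
  auxiliary primes (design `δ ∈ {0,1}`), resp. the conclusion of `HeegnerTwistCouplingInSupply` at `(E_{2n}, P₀)` for realising primes in the size
  window, modulo Burungale–Tian.
* ★★ `finrank_augKernel_one_inf_ker_snd_le_of_one_five` — ODD, ANY classes, exactly one prime `≡ 5 (mod 8)` (index `b₅`): `dim (𝒦⁺(1) ∩ V×0)
  ≤ τ₀` (the section is dominated by `𝒦₁ = {(x, c·1) ∈ 𝒦}`, whose part `{(x,0) : x_{b₅} = 0}` swaps into `𝒦 ∩ 0×V`, disjoint from `𝒦₁` inside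
  `𝒦` of odd dimension). Numerics probe26.py: 3 152 such bases, δ = 1 good in all (three primes `≡ 5`: fails in 32 %).
* ★★★ `exists_patternFree_design_of_one_five_odd` / `exists_recipe_cruxOn_odd_of_one_five` — hence EVERY odd base `E_{P₀⋯P_k}` with all
  `P_b ≡ 1, 3, 5 (mod 8)` and exactly one `≡ 5 (mod 8)` admits a pattern-free Heegner recipe with `τ₀ + 1` auxiliary primes (`δ = 1`), resp. the crux
  conclusion at `(E_n, P₀)` modulo Burungale–Tian.
HONEST FRAMING: RUNG-LEVEL corner layer (congruent `j = 1728` families); `𝔽₂`-linear algebra attached to Monsky matrices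
[cite: HeathBrown1994SelmerCongruentII, Appendix (Monsky), typescript pp. 39–41]; instances need located primes (w4 layer) and the print input
[cite: BurungaleTian2026, Thm. 1.1]; the crux as stated (C⁺), its registered stubs and BSD are NOT touched; nothing is closed. THEOREMS ONLY.
-/

namespace Summit.BirchSwinnertonDyer.BirchSwinnertonDyer.Theorems.SymbolicMonsky

section FewFives

open Module Matrix Literature.NumberTheory.EllipticCurves Literature.NumberTheory.EllipticCurves.HeathBrown1994
  Literature.NumberTheory.EllipticCurves.HeathBrown1994.Families
open Literature.NumberTheory.EllipticCurves.Rank1Residual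

variable {k : ℕ} (base : SymbData (k + 1))

/-- Column sums of the Laplacian: `Σ_i Σ_j [(P_j/P_i) = −1](y_j + y_i) = (1 + μ)⟨m,y⟩` (quadratic reciprocity `bz_neg_swap`). [folklore] -/
private theorem sum_lap_eq_one_add_mu_mul₉ (y : Fin (k + 1) → ZMod 2) :
    (∑ i, ∑ j, bz (base.neg i j) * (y j + y i)) =
      (1 + ∑ b, bz (negNegOne (base.cls b))) * ∑ j, bz (negNegOne (base.cls j)) * y j := by
  have h2 : ∀ x : ZMod 2, x + x = 0 := by decide
  have hsq : ∀ x : ZMod 2, x * x = x := by decide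
  have e1 : (∑ i, ∑ j, bz (base.neg i j) * (y j + y i)) = ∑ i, ∑ j, (bz (base.neg j i) + bz (base.neg i j)) * y i := by
    have : (∑ i, ∑ j, bz (base.neg i j) * (y j + y i)) = (∑ i, ∑ j, bz (base.neg i j) * y j) + ∑ i, ∑ j, bz (base.neg i j) * y i := by
      rw [← Finset.sum_add_distrib]
      refine Finset.sum_congr rfl fun i _ => ?_
      rw [← Finset.sum_add_distrib]
      exact Finset.sum_congr rfl fun j _ => by ring
    rw [this, Finset.sum_comm, ← Finset.sum_add_distrib]
    refine Finset.sum_congr rfl fun i _ => ?_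
    rw [← Finset.sum_add_distrib]
    exact Finset.sum_congr rfl fun j _ => by ring
  have e2 : ∀ i, (∑ j, (bz (base.neg j i) + bz (base.neg i j)) * y i) =
      (∑ j, bz (negNegOne (base.cls i)) * bz (negNegOne (base.cls j)) * y i) + bz (negNegOne (base.cls i)) * y i := by
    intro i
    have hpt : ∀ j, (bz (base.neg j i) + bz (base.neg i j)) * y i =
        bz (negNegOne (base.cls i)) * bz (negNegOne (base.cls j)) * y i + (if j = i then bz (negNegOne (base.cls i)) * y i else 0) := by
      intro j
      by_cases hji : j = i
      · subst hji
        rw [if_pos rfl]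
        linear_combination (h2 (bz (base.neg j j))) * y j - (hsq (bz (negNegOne (base.cls j)))) * y j -
          h2 (bz (negNegOne (base.cls j)) * y j)
      · have hij : i ≠ j := fun h => hji h.symm
        rw [if_neg hji, base.bz_neg_swap hij, bz_and_mul]
        linear_combination (h2 (bz (base.neg i j))) * y i
    rw [Finset.sum_congr rfl fun j _ => hpt j, Finset.sum_add_distrib, Finset.sum_ite_eq' Finset.univ i]
    simp only [Finset.mem_univ, if_true]
  rw [e1, Finset.sum_congr rfl fun i _ => e2 i, Finset.sum_add_distrib, add_mul, one_mul, Finset.mul_sum]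
  have e3 : ∀ i, (∑ j, bz (negNegOne (base.cls i)) * bz (negNegOne (base.cls j)) * y i) =
      (∑ b, bz (negNegOne (base.cls b))) * (bz (negNegOne (base.cls i)) * y i) := by
    intro i
    rw [Finset.sum_mul]
    exact Finset.sum_congr rfl fun j _ => by ring
  rw [Finset.sum_congr rfl fun i _ => e3 i, add_comm]

/-- Cutting a subspace by one linear functional costs at most one dimension. -/
private theorem finrank_le_finrank_inf_ker_add_one₉ {Z : Type*} [AddCommGroup Z] [Module (ZMod 2) Z] [FiniteDimensional (ZMod 2) Z]
    (C : Submodule (ZMod 2) Z) (f : Z →ₗ[ZMod 2] ZMod 2) :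
    finrank (ZMod 2) ↥C ≤ finrank (ZMod 2) ↥(C ⊓ LinearMap.ker f) + 1 := by
  have h1 := Submodule.finrank_sup_add_finrank_inf_eq C (LinearMap.ker f)
  have h2 := LinearMap.finrank_range_add_finrank_ker f
  have h3 : finrank (ZMod 2) ↥(LinearMap.range f) ≤ 1 := by
    have := Submodule.finrank_le (LinearMap.range f)
    rwa [Module.finrank_self] at this
  have h4 : finrank (ZMod 2) ↥(C ⊔ LinearMap.ker f) ≤ finrank (ZMod 2) Z := Submodule.finrank_le _
  omega

/-- ★★ **EVEN, any classes, at most three primes `≡ 5 (mod 8)`: the vertical kernel pairs span `≤ τ₀` dimensions** — a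
vertical-exceptional even base (memo EVEN-EXCEPTIONAL-CLASS-w3g24) needs at least FOUR primes `≡ 5 (mod 8)`. [cite: HeathBrown1994SelmerCongruentII, Appendix (Monsky), typescript p. 41 L20–L36] -/
theorem finrank_vertical_le_of_three_fives (hμ : (∑ b, bz (negNegOne (base.cls b))) = 1)
    (b₁ b₂ b₃ : Fin (k + 1)) (h5 : ∀ b, negTwo (base.cls b) = true → negNegOne (base.cls b) = false → (b = b₁ ∨ b = b₂ ∨ b = b₃)) :
    finrank (ZMod 2) ↥(base.evenVirtualKernel ⊓
      LinearMap.ker (LinearMap.fst (ZMod 2) (Fin (k + 1) → ZMod 2) (Fin (k + 1) → ZMod 2))) ≤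
        (finrank (ZMod 2) ↥base.evenVirtualKernel + 1) / 2 := by
  have h2 : ∀ x : ZMod 2, x + x = 0 := by decide
  set P := base.evenVirtualKernel ⊓ LinearMap.ker (LinearMap.fst (ZMod 2) (Fin (k + 1) → ZMod 2) (Fin (k + 1) → ZMod 2)) with hP
  set Q := base.evenVirtualKernel ⊓ LinearMap.ker (LinearMap.snd (ZMod 2) (Fin (k + 1) → ZMod 2) (Fin (k + 1) → ZMod 2)) with hQ
  set f₁ : ((Fin (k + 1) → ZMod 2) × (Fin (k + 1) → ZMod 2)) →ₗ[ZMod 2] ZMod 2 :=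
    (LinearMap.proj b₁).comp (LinearMap.snd (ZMod 2) (Fin (k + 1) → ZMod 2) (Fin (k + 1) → ZMod 2)) with hf₁
  set f₂ : ((Fin (k + 1) → ZMod 2) × (Fin (k + 1) → ZMod 2)) →ₗ[ZMod 2] ZMod 2 :=
    (LinearMap.proj b₂).comp (LinearMap.snd (ZMod 2) (Fin (k + 1) → ZMod 2) (Fin (k + 1) → ZMod 2)) with hf₂
  set P₀ := (P ⊓ LinearMap.ker f₁) ⊓ LinearMap.ker f₂ with hP₀
  set e := LinearEquiv.prodComm (ZMod 2) (Fin (k + 1) → ZMod 2) (Fin (k + 1) → ZMod 2) with he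
  -- the swap `(0, v) ↦ (v, 0)` maps `P₀` into `Q`
  have hP₀Q : P₀.map e.toLinearMap ≤ Q := by
    intro q hq
    obtain ⟨p, hp, rfl⟩ := Submodule.mem_map.1 hq
    obtain ⟨hp1, hpb₂⟩ := Submodule.mem_inf.1 hp
    obtain ⟨hpP, hpb₁⟩ := Submodule.mem_inf.1 hp1
    obtain ⟨hpK, hp0⟩ := Submodule.mem_inf.1 hpP
    rw [LinearMap.mem_ker, LinearMap.fst_apply] at hp0
    rw [LinearMap.mem_ker, hf₁, LinearMap.comp_apply, LinearMap.snd_apply, LinearMap.proj_apply] at hpb₁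
    rw [LinearMap.mem_ker, hf₂, LinearMap.comp_apply, LinearMap.snd_apply, LinearMap.proj_apply] at hpb₂
    obtain ⟨hE1, hE2⟩ := (mem_evenVirtualKernel_iff base p).1 hpK
    set v := p.2 with hv
    -- the kernel equations of `(0, v)`
    have hmv : ∀ i, bz (negNegOne (base.cls i)) * v i = 0 := fun i => by
      have e := hE1 i
      simp only [hp0, Pi.zero_apply, add_zero, mul_zero, Finset.sum_const_zero, zero_add] at e
      exact e
    have hMv : (∑ j, bz (negNegOne (base.cls j)) * v j) = 0 := Finset.sum_eq_zero fun j _ => hmv j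
    have e2 : ∀ i, (∑ j, bz (base.neg i j) * (v j + v i)) + bz (negTwo (base.cls i)) * v i = 0 := fun i => by
      have e := hE2 i
      simp only [hp0, Pi.zero_apply, mul_zero, Finset.sum_const_zero, zero_add, add_zero, hmv i] at e
      exact e
    -- parity: `Σ_i d_i v_i = 0`
    have hpar : (∑ i, bz (negTwo (base.cls i)) * v i) = 0 := by
      have hs : (∑ i, ((∑ j, bz (base.neg i j) * (v j + v i)) + bz (negTwo (base.cls i)) * v i)) = 0 := Finset.sum_eq_zero fun i _ => e2 i
      rw [Finset.sum_add_distrib, sum_lap_eq_one_add_mu_mul₉ base v, hMv, mul_zero, zero_add] at hs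
      exact hs
    -- `d_i v_i = 0` for every `i` (classes 3: from `m_i v_i = 0`; classes 5: `b₁`, `b₂` directly, `b₃` by the parity)
    have hdv12 : ∀ i, i ≠ b₃ → bz (negTwo (base.cls i)) * v i = 0 := fun i hi3 => by
      cases hd : negTwo (base.cls i) with
      | false => exact zero_mul _
      | true =>
        cases hm : negNegOne (base.cls i) with
        | true => have := hmv i; rw [hm] at this; exact this
        | false =>
          rcases h5 i hd hm with h | h | h
          · rw [h, hpb₁]; exact mul_zero _
          · rw [h, hpb₂]; exact mul_zero _
          · exact absurd h hi3
    have hdv : ∀ i, bz (negTwo (base.cls i)) * v i = 0 := fun i => by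
      by_cases hi3 : i = b₃
      · rw [Finset.sum_eq_single b₃ (fun j _ hj => hdv12 j hj) (fun h => absurd (Finset.mem_univ _) h)] at hpar
        rw [hi3]; exact hpar
      · exact hdv12 i hi3
    have hlap : ∀ i, (∑ j, bz (base.neg i j) * (v j + v i)) = 0 := fun i => by
      have e := e2 i
      rw [hdv i, add_zero] at e
      exact e
    have hv0 : (v, (0 : Fin (k + 1) → ZMod 2)) ∈ base.evenVirtualKernel := by
      rw [mem_evenVirtualKernel_iff]
      refine ⟨fun i => ?_, fun i => ?_⟩
      · simp only [Pi.zero_apply, mul_zero, add_zero, hMv]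
        linear_combination hlap i + hdv i
      · simp only [Pi.zero_apply, mul_zero, add_zero, Finset.sum_const_zero, hMv]
        linear_combination hdv i
    have hsw : e.toLinearMap p = (v, 0) := by
      rw [LinearEquiv.coe_toLinearMap, he, LinearEquiv.prodComm_apply, Prod.swap, hp0]
    rw [hsw]
    exact Submodule.mem_inf.2 ⟨hv0, by rw [LinearMap.mem_ker, LinearMap.snd_apply]⟩
  -- dimension count inside `𝒦_ev`
  have hle : finrank (ZMod 2) ↥(P₀.map e.toLinearMap) ≤ finrank (ZMod 2) ↥Q := Submodule.finrank_mono hP₀Q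
  rw [← LinearEquiv.finrank_eq (Submodule.equivMapOfInjective _ e.injective P₀)] at hle
  have hcod₁ := finrank_le_finrank_inf_ker_add_one₉ P f₁
  have hcod₂ : finrank (ZMod 2) ↥(P ⊓ LinearMap.ker f₁) ≤ finrank (ZMod 2) ↥P₀ + 1 := finrank_le_finrank_inf_ker_add_one₉ _ f₂
  have hPQ : P ⊓ Q = ⊥ := by
    rw [Submodule.eq_bot_iff]
    intro p hp
    obtain ⟨hpP, hpQ⟩ := Submodule.mem_inf.1 hp
    have h1 : p.1 = 0 := by
      have := (Submodule.mem_inf.1 hpP).2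
      rwa [LinearMap.mem_ker, LinearMap.fst_apply] at this
    have h2' : p.2 = 0 := by
      have := (Submodule.mem_inf.1 hpQ).2
      rwa [LinearMap.mem_ker, LinearMap.snd_apply] at this
    exact Prod.ext h1 h2'
  have hsup : P ⊔ Q ≤ base.evenVirtualKernel := sup_le inf_le_left inf_le_left
  have hsum := Submodule.finrank_sup_add_finrank_inf_eq P Q
  rw [hPQ, finrank_bot, add_zero] at hsum
  have hmono := Submodule.finrank_mono hsup
  obtain ⟨r, hr⟩ := odd_finrank_evenVirtualKernel base hμ
  omega

/-- ★★★ **Recipe for every even base with classes `{1,3,5}` and at most three primes `≡ 5 (mod 8)`** (pattern-free Heegner recipe with `τ₀ + 1`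
auxiliary primes, design `δ ∈ {0,1}`). [cite: HeathBrown1994SelmerCongruentII, Appendix (Monsky), typescript p. 41 L20–L36] -/
theorem exists_patternFree_even_design_of_three_fives
    (h7 : ∀ b, negNegOne (base.cls b) = true → negTwo (base.cls b) = true) (hμ : (∑ b, bz (negNegOne (base.cls b))) = 1)
    (b₁ b₂ b₃ : Fin (k + 1)) (h5 : ∀ b, negTwo (base.cls b) = true → negNegOne (base.cls b) = false → (b = b₁ ∨ b = b₂ ∨ b = b₃)) :
    ∃ (c₁ : AuxCell) (rest : List AuxCell), rest.length = (finrank (ZMod 2) ↥base.evenVirtualKernel + 1) / 2 ∧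
      heegnerK base (c₁ :: rest) = true ∧ ∀ pat : ℕ → ℕ → Bool, (dataK base (c₁ :: rest) pat).monskyEvenS.det = 1 :=
  exists_patternFree_even_design_of_noSeven_of_vertical_le base h7 hμ
    (finrank_vertical_le_of_three_fives base hμ b₁ b₂ b₃ h5)

/-- ★★★ **The same through the realisation door** (conclusion of `HeegnerTwistCouplingInSupply` at `(E_{2n}, P₀)` for realising primes in the size
window, modulo Burungale–Tian). [cite: HeathBrown1994SelmerCongruentII, Appendix (Monsky), typescript p. 41 L20–L36] [cite: BurungaleTian2026, Thm. 1.1]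
[cite: Oesterle1988Gauss, II §3 Proposition p. 57 (27)] -/
theorem exists_recipe_cruxOn_even_of_three_fives (hBT : burungaleTian_analyticRank_eq_zero_of_selmerCorank_eq_zero_of_hasCM)
    (h7 : ∀ b, negNegOne (base.cls b) = true → negTwo (base.cls b) = true) (hμ : (∑ b, bz (negNegOne (base.cls b))) = 1)
    (b₁ b₂ b₃ : Fin (k + 1)) (h5 : ∀ b, negTwo (base.cls b) = true → negNegOne (base.cls b) = false → (b = b₁ ∨ b = b₂ ∨ b = b₃)) :
    ∃ aux : List AuxCell, aux.length = (finrank (ZMod 2) ↥base.evenVirtualKernel + 1) / 2 + 1 ∧ heegnerK base aux = true ∧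
      ∀ (P : Fin (k + 1) → ℕ) (q : Fin aux.length → ℕ), RealisesK base aux P q →
        ∀ (n : ℕ) [(congruentNumberCurve (2 * n)).IsElliptic], (∏ b, P b) = n →
          Real.sqrt ((∏ j, q j : ℕ) : ℝ) * Real.log ((∏ j, q j : ℕ) : ℝ) < Real.pi * P 0 →
          ∃ (K : Type) (_ : Field K) (_ : NumberField K),
            IsImaginaryQuadratic K ∧ 4 < (NumberField.discr K).natAbs ∧
            SatisfiesHeegnerHypothesis ((congruentNumberCurve (2 * n)).conductorNorm ℤ) K ∧
            ((congruentNumberCurve (2 * n)).quadraticTwist (NumberField.discr K : ℚ)).entireLFunction 1 ≠ 0 ∧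
            ¬ P 0 ∣ NumberField.classNumber K :=
  exists_recipe_cruxOn_even_of_noSeven_of_vertical_le base hBT h7 hμ
    (finrank_vertical_le_of_three_fives base hμ b₁ b₂ b₃ h5)

/-- ★★ **ODD, any classes, exactly one prime `≡ 5 (mod 8)` (index `b₅`): `dim (𝒦⁺(1) ∩ V×0) ≤ τ₀`.**
[cite: HeathBrown1994SelmerCongruentII, Appendix (Monsky), typescript pp. 39–41] -/
theorem finrank_augKernel_one_inf_ker_snd_le_of_one_five
    (hroot : (∑ b, (bz (negNegOne (base.cls b)) + bz (negTwo (base.cls b)))) = 1)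
    (b₅ : Fin (k + 1)) (hb₅ : negTwo (base.cls b₅) = true)
    (h5 : ∀ b, negTwo (base.cls b) = true → negNegOne (base.cls b) = false → b = b₅) :
    finrank (ZMod 2) ↥(base.augKernel (fun _ => 1) ⊓
        LinearMap.ker (LinearMap.snd (ZMod 2) (Fin (k + 1) → ZMod 2) (Fin (k + 1) → ZMod 2))) ≤
      (finrank (ZMod 2) ↥base.virtualKernel + 1) / 2 := by
  have h2 : ∀ x : ZMod 2, x + x = 0 := by decide
  -- `𝒦₁ = {(x, y) ∈ 𝒦 : y ∈ ⟨1⟩}`, `P = 𝒦 ∩ V×0`, `Q = 𝒦 ∩ 0×V`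
  set K₁ := base.virtualKernel ⊓ Submodule.comap (LinearMap.snd (ZMod 2) (Fin (k + 1) → ZMod 2) (Fin (k + 1) → ZMod 2))
    (Submodule.span (ZMod 2) {fun _ : Fin (k + 1) => (1 : ZMod 2)}) with hK₁
  set Q := base.virtualKernel ⊓ LinearMap.ker (LinearMap.fst (ZMod 2) (Fin (k + 1) → ZMod 2) (Fin (k + 1) → ZMod 2)) with hQ
  set g₀ : ((Fin (k + 1) → ZMod 2) × (Fin (k + 1) → ZMod 2)) →ₗ[ZMod 2] ZMod 2 :=
    (LinearMap.proj 0).comp (LinearMap.snd (ZMod 2) (Fin (k + 1) → ZMod 2) (Fin (k + 1) → ZMod 2)) with hg₀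
  set g₅ : ((Fin (k + 1) → ZMod 2) × (Fin (k + 1) → ZMod 2)) →ₗ[ZMod 2] ZMod 2 :=
    (LinearMap.proj b₅).comp (LinearMap.fst (ZMod 2) (Fin (k + 1) → ZMod 2) (Fin (k + 1) → ZMod 2)) with hg₅
  set P₀ := (K₁ ⊓ LinearMap.ker g₀) ⊓ LinearMap.ker g₅ with hP₀
  set e := LinearEquiv.prodComm (ZMod 2) (Fin (k + 1) → ZMod 2) (Fin (k + 1) → ZMod 2) with he
  -- (i) the `V × 0` section of `𝒦⁺(1)` is dominated by `𝒦₁`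
  set ψ₁ := (LinearMap.inl (ZMod 2) (Fin (k + 1) → ZMod 2) (Fin (k + 1) → ZMod 2)).comp
      (LinearMap.fst (ZMod 2) (Fin (k + 1) → ZMod 2) (Fin (k + 1) → ZMod 2) +
        (LinearMap.toSpanSingleton (ZMod 2) (Fin (k + 1) → ZMod 2) (fun _ => 1)).comp g₀) with hψ₁
  have hψ₁_apply : ∀ q : (Fin (k + 1) → ZMod 2) × (Fin (k + 1) → ZMod 2), ψ₁ q = (fun b => q.1 b + q.2 0, 0) := fun q => by
    refine Prod.ext (funext fun b => ?_) rfl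
    simp [hψ₁, hg₀]
  have hle1 : base.augKernel (fun _ => 1) ⊓ LinearMap.ker (LinearMap.snd (ZMod 2) (Fin (k + 1) → ZMod 2) (Fin (k + 1) → ZMod 2)) ≤
      K₁.map ψ₁ := by
    intro p hp
    obtain ⟨hpW, hp0⟩ := Submodule.mem_inf.1 hp
    obtain ⟨q, hq, c, rfl⟩ := exists_of_mem_augKernel base (fun _ => 1) hpW
    rw [LinearMap.mem_ker, LinearMap.snd_apply] at hp0
    have hq2 : ∀ b, q.2 b = c := fun b => by
      have := congrFun hp0 b
      simp only [Prod.snd_add, Prod.smul_snd, Pi.add_apply, Pi.smul_apply, smul_eq_mul, mul_one, Pi.zero_apply] at this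
      linear_combination this - h2 c
    have hqK : q ∈ K₁ := by
      refine Submodule.mem_inf.2 ⟨hq, ?_⟩
      rw [Submodule.mem_comap, LinearMap.snd_apply, Submodule.mem_span_singleton]
      exact ⟨c, funext fun b => by simp [hq2 b]⟩
    refine Submodule.mem_map.2 ⟨q, hqK, ?_⟩
    rw [hψ₁_apply]
    refine Prod.ext (funext fun b => ?_) ?_
    · simp [hq2]
    · exact hp0.symm
  -- (ii) `K₁ ∩ ker g₀ ≤ 𝒦 ∩ V×0`, and its part with `x_{b₅} = 0` swaps into `Q`
  have hP₀Q : P₀.map e.toLinearMap ≤ Q := by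
    intro q' hq'
    obtain ⟨q, hq, rfl⟩ := Submodule.mem_map.1 hq'
    obtain ⟨hq1, hq5⟩ := Submodule.mem_inf.1 hq
    obtain ⟨hqK₁, hq0⟩ := Submodule.mem_inf.1 hq1
    obtain ⟨hqK, hqs⟩ := Submodule.mem_inf.1 hqK₁
    rw [Submodule.mem_comap, LinearMap.snd_apply, Submodule.mem_span_singleton] at hqs
    obtain ⟨c, hc⟩ := hqs
    rw [LinearMap.mem_ker, hg₀, LinearMap.comp_apply, LinearMap.snd_apply, LinearMap.proj_apply] at hq0
    rw [LinearMap.mem_ker, hg₅, LinearMap.comp_apply, LinearMap.fst_apply, LinearMap.proj_apply] at hq5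
    have hc0 : c = 0 := by
      have := congrFun hc 0
      simp only [Pi.smul_apply, smul_eq_mul, mul_one] at this
      rw [this]; exact hq0
    have hy : q.2 = 0 := by rw [← hc, hc0, zero_smul]
    obtain ⟨hE1, hE2⟩ := (mem_virtualKernel_iff base q).1 hqK
    set x := q.1 with hx
    have hmx : ∀ i, bz (negNegOne (base.cls i)) * x i = 0 := fun i => by
      have e := hE2 i
      simp only [hy, Pi.zero_apply, add_zero, mul_zero, Finset.sum_const_zero] at e
      exact e
    have hlap : ∀ i, (∑ j, bz (base.neg i j) * (x j + x i)) = 0 := fun i => by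
      have e := hE1 i
      simp only [hy, Pi.zero_apply, mul_zero, add_zero, hmx i] at e
      exact e
    have hdx : ∀ i, bz (negTwo (base.cls i)) * x i = 0 := fun i => by
      cases hd : negTwo (base.cls i) with
      | false => exact zero_mul _
      | true =>
        cases hm : negNegOne (base.cls i) with
        | true => have := hmx i; rw [hm] at this; exact this
        | false => rw [h5 i hd hm, hq5]; exact mul_zero _
    have h0x : ((0 : Fin (k + 1) → ZMod 2), x) ∈ base.virtualKernel := by
      rw [mem_virtualKernel_iff]
      refine ⟨fun i => ?_, fun i => ?_⟩
      · simp only [Pi.zero_apply, add_zero, mul_zero, Finset.sum_const_zero, zero_add]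
        exact hdx i
      · simp only [Pi.zero_apply, mul_zero, zero_add]
        exact hlap i
    have hsw : e.toLinearMap q = (0, x) := by
      rw [LinearEquiv.coe_toLinearMap, he, LinearEquiv.prodComm_apply, Prod.swap, hy]
    rw [hsw]
    exact Submodule.mem_inf.2 ⟨h0x, by rw [LinearMap.mem_ker, LinearMap.fst_apply]⟩
  -- (iii) `K₁ ∩ Q = 0` (uses the prime `≡ 5 (mod 8)`: `(0, c·1) ∈ 𝒦 ⇒ c·d_{b₅} = 0`)
  have hKQ : K₁ ⊓ Q = ⊥ := by
    rw [Submodule.eq_bot_iff]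
    intro q hq
    obtain ⟨hqK₁, hqQ⟩ := Submodule.mem_inf.1 hq
    obtain ⟨hqK, hqs⟩ := Submodule.mem_inf.1 hqK₁
    have hq1 : q.1 = 0 := by
      have := (Submodule.mem_inf.1 hqQ).2
      rwa [LinearMap.mem_ker, LinearMap.fst_apply] at this
    rw [Submodule.mem_comap, LinearMap.snd_apply, Submodule.mem_span_singleton] at hqs
    obtain ⟨c, hc⟩ := hqs
    have e := ((mem_virtualKernel_iff base q).1 hqK).1 b₅
    rw [hq1, ← hc] at e
    simp only [Pi.zero_apply, add_zero, mul_zero, Finset.sum_const_zero, zero_add, Pi.smul_apply, smul_eq_mul, mul_one, hb₅] at e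
    have hb : bz true = 1 := rfl
    rw [hb, one_mul] at e
    have hq2 : q.2 = 0 := by rw [← hc, e, zero_smul]
    exact Prod.ext hq1 hq2
  -- count
  have hleA : finrank (ZMod 2) ↥(base.augKernel (fun _ => 1) ⊓
      LinearMap.ker (LinearMap.snd (ZMod 2) (Fin (k + 1) → ZMod 2) (Fin (k + 1) → ZMod 2))) ≤ finrank (ZMod 2) ↥K₁ :=
    (Submodule.finrank_mono hle1).trans (Submodule.finrank_map_le _ _)
  have hle : finrank (ZMod 2) ↥(P₀.map e.toLinearMap) ≤ finrank (ZMod 2) ↥Q := Submodule.finrank_mono hP₀Q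
  rw [← LinearEquiv.finrank_eq (Submodule.equivMapOfInjective _ e.injective P₀)] at hle
  have hcod₁ := finrank_le_finrank_inf_ker_add_one₉ K₁ g₀
  have hcod₂ : finrank (ZMod 2) ↥(K₁ ⊓ LinearMap.ker g₀) ≤ finrank (ZMod 2) ↥P₀ + 1 := finrank_le_finrank_inf_ker_add_one₉ _ g₅
  have hsup : K₁ ⊔ Q ≤ base.virtualKernel := sup_le inf_le_left inf_le_left
  have hsum := Submodule.finrank_sup_add_finrank_inf_eq K₁ Q
  rw [hKQ, finrank_bot, add_zero] at hsum
  have hmono := Submodule.finrank_mono hsup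
  obtain ⟨r, hr⟩ := odd_finrank_virtualKernel base hroot
  omega

/-- ★★★ **Recipe for every odd base with classes `{1,3,5}` and exactly one prime `≡ 5 (mod 8)`** (pattern-free Heegner recipe with `τ₀ + 1`
auxiliary primes, `δ = 1`). [cite: HeathBrown1994SelmerCongruentII, Appendix (Monsky), typescript pp. 39–41] -/
theorem exists_patternFree_design_of_one_five_odd
    (h7 : ∀ b, negNegOne (base.cls b) = true → negTwo (base.cls b) = true)
    (hroot : (∑ b, (bz (negNegOne (base.cls b)) + bz (negTwo (base.cls b)))) = 1)
    (b₅ : Fin (k + 1)) (hb₅ : negTwo (base.cls b₅) = true)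
    (h5 : ∀ b, negTwo (base.cls b) = true → negNegOne (base.cls b) = false → b = b₅) :
    ∃ (c₁ : AuxCell) (rest : List AuxCell), rest.length = (finrank (ZMod 2) ↥base.virtualKernel + 1) / 2 ∧
      heegnerK base (c₁ :: rest) = true ∧ ∀ pat : ℕ → ℕ → Bool, (dataK base (c₁ :: rest) pat).monskyOddS.det = 1 :=
  exists_patternFree_design_one_of_noSeven_odd base h7 hroot
    (finrank_augKernel_one_inf_ker_snd_le_of_one_five base hroot b₅ hb₅ h5)

/-- ★★★ **The same through the realisation door** (conclusion of `HeegnerTwistCouplingInSupply` at `(E_n, P₀)` modulo Burungale–Tian).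
[cite: HeathBrown1994SelmerCongruentII, Appendix (Monsky), typescript pp. 39–41] [cite: BurungaleTian2026, Thm. 1.1]
[cite: Oesterle1988Gauss, II §3 Proposition p. 57 (27)] -/
theorem exists_recipe_cruxOn_odd_of_one_five (hBT : burungaleTian_analyticRank_eq_zero_of_selmerCorank_eq_zero_of_hasCM)
    (h7 : ∀ b, negNegOne (base.cls b) = true → negTwo (base.cls b) = true)
    (hroot : (∑ b, (bz (negNegOne (base.cls b)) + bz (negTwo (base.cls b)))) = 1)
    (b₅ : Fin (k + 1)) (hb₅ : negTwo (base.cls b₅) = true)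
    (h5 : ∀ b, negTwo (base.cls b) = true → negNegOne (base.cls b) = false → b = b₅) :
    ∃ aux : List AuxCell, aux.length = (finrank (ZMod 2) ↥base.virtualKernel + 1) / 2 + 1 ∧ heegnerK base aux = true ∧
      ∀ (P : Fin (k + 1) → ℕ) (q : Fin aux.length → ℕ), RealisesK base aux P q →
        ∀ (n : ℕ) [(congruentNumberCurve n).IsElliptic], (∏ b, P b) = n →
          Real.sqrt ((∏ j, q j : ℕ) : ℝ) * Real.log ((∏ j, q j : ℕ) : ℝ) < Real.pi * P 0 →
          ∃ (K : Type) (_ : Field K) (_ : NumberField K),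
            IsImaginaryQuadratic K ∧ 4 < (NumberField.discr K).natAbs ∧
            SatisfiesHeegnerHypothesis ((congruentNumberCurve n).conductorNorm ℤ) K ∧
            ((congruentNumberCurve n).quadraticTwist (NumberField.discr K : ℚ)).entireLFunction 1 ≠ 0 ∧
            ¬ P 0 ∣ NumberField.classNumber K :=
  exists_recipe_cruxOn_odd_one_of_noSeven base hBT h7 hroot
    (finrank_augKernel_one_inf_ker_snd_le_of_one_five base hroot b₅ hb₅ h5)

end FewFives

end Summit.BirchSwinnertonDyer.BirchSwinnertonDyer.Theorems.SymbolicMonsky
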